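import Mathlib.RingTheory.Smooth.Basic
import Mathlib.RingTheory.RingHom.Smooth
import Mathlib.Algebra.TrivSqZeroExt.Ideal
import HarnessLib

/-!
# Point derivations extend along formally smooth ring homomorphisms

Topic `Literature/RingTheory/Smooth`. Let `φ : R → S` be a formally smooth ring homomorphism
(Stacks Project, Tags 00TI and 031J: the infinitesimal lifting property; EGA IV₄ §17), let
`P : S → K` be a ring homomorphism ("a `K`-point of `S`") and `Q = P ∘ φ` the induced point of `R`.
A *point derivation* of `R` at `Q` is an additive map `D : R → K` with the Leibniz rule
`D(ab) = Q(a) D(b) + Q(b) D(a)`, i.e. a tangent vector of `Spec R` at `Q`; likewise for `S` at `P`.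

* `Literature.RingTheory.Smooth.exists_pointDerivation_comp_eq` — **every point derivation of `R` at
  `Q` is the restriction of a point derivation of `S` at `P`**: the tangent map
  `T_P(Spec S) → T_Q(Spec R)` of a formally smooth morphism is onto (the lifting property of
  Stacks Tag 00TI applied to the dual numbers). Proof: `a ↦ Q(a) + D(a) ε` is a ring
  homomorphism `R → K[ε]` to the dual numbers (`TrivSqZeroExt K K`), making `K[ε]` an `R`-algebra
  in which `(ε)` is a square-zero ideal with quotient the `R`-algebra `K` (via `Q`); formal
  smoothness of `S` over `R` (Mathlib `Algebra.FormallySmooth.liftOfSurjective`) lifts the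
  `R`-algebra map `P : S → K` to `S → K[ε]`, whose `ε`-component is the required derivation.

This is the algebraic half of "a smooth morphism of smooth `ℂ`-schemes induces a submersion on
complex points" (SGA1 XII Prop. 3.1; used for Ehresmann's theorem on the tubes of a smooth proper
family, `Literature.AlgebraicGeometry.Motives.Voisin2002_tubeRestrict_isIso`). Everything is proved;
no named facts.

## References

* The Stacks Project, Tags 00TI, 031J (formally smooth ring maps, infinitesimal lifting
  property), Tag 02G2 (smooth ring maps). [StacksProject]
* A. Grothendieck, *EGA IV₄*, Publ. Math. IHÉS 32 (1967), §17 (Prop. 17.2.6, Thm. 17.11.1).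
-/

namespace Literature.RingTheory.Smooth

open TrivSqZeroExt

/-- **Point derivations extend along formally smooth maps.** Let `φ : R →+* S` be formally smooth,
`P : S →+* K` a ring homomorphism and `D : R →+ K` a point derivation of `R` at `Q = P ∘ φ`
(`D (a * b) = Q a * D b + Q b * D a`). Then there is a point derivation `D'` of `S` at `P`
(`D' (x * y) = P x * D' y + P y * D' x`) with `D' ∘ φ = D`. (Dual-number reformulation of the
infinitesimal lifting property: lift `P` along `K[ε] → K` for the `R`-algebra structure
`a ↦ Q a + D a • ε` on `K[ε]`.) [cite: StacksProject, Tag 00TI (with Tag 031J)] -/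
theorem exists_pointDerivation_comp_eq {R S K : Type*} [CommRing R] [CommRing S] [CommRing K]
    {φ : R →+* S} (hφ : φ.FormallySmooth) (P : S →+* K) (D : R →+ K)
    (hD : ∀ a b, D (a * b) = P (φ a) * D b + P (φ b) * D a) :
    ∃ D' : S →+ K, (∀ x y, D' (x * y) = P x * D' y + P y * D' x) ∧ ∀ a, D' (φ a) = D a := by
  classical
  letI : Algebra R S := φ.toAlgebra
  haveI : Algebra.FormallySmooth R S := hφ
  -- the point `Q = P ∘ φ` of `R`
  set Q : R →+* K := P.comp φ with hQ
  have hQa : ∀ a, Q a = P (φ a) := fun a => rfl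
  have hD1 : D 1 = 0 := by
    have h := hD 1 1
    rw [mul_one, φ.map_one, P.map_one, one_mul] at h
    -- `h : D 1 = D 1 + D 1`
    have h' : D 1 + D 1 = D 1 + 0 := by rw [add_zero]; exact h.symm
    exact add_left_cancel h'
  -- the ring homomorphism `θ : R → K[ε]`, `a ↦ Q a + D a • ε`
  let θ : R →+* TrivSqZeroExt K K :=
    { toFun := fun a => ((Q a, D a) : TrivSqZeroExt K K)
      map_one' := by
        refine TrivSqZeroExt.ext ?_ ?_
        · simp
        · simpa using hD1
      map_mul' := fun a b => by
        refine TrivSqZeroExt.ext ?_ ?_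
        · simp
        · simp only [TrivSqZeroExt.snd_mul, TrivSqZeroExt.snd_mk, TrivSqZeroExt.fst_mk,
            smul_eq_mul, MulOpposite.smul_eq_mul_unop, MulOpposite.unop_op, hD, hQa]
          ring
      map_zero' := by
        refine TrivSqZeroExt.ext ?_ ?_ <;> simp
      map_add' := fun a b => by
        refine TrivSqZeroExt.ext ?_ ?_ <;> simp }
  have hθ : ∀ a, θ a = ((Q a, D a) : TrivSqZeroExt K K) := fun a => rfl
  letI algRT : Algebra R (TrivSqZeroExt K K) := θ.toAlgebra
  letI algRK : Algebra R K := Q.toAlgebra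
  -- `fst : K[ε] → K` is an `R`-algebra surjection with square-zero kernel
  let g : TrivSqZeroExt K K →ₐ[R] K :=
    { (TrivSqZeroExt.fstHom K K K).toRingHom with
      commutes' := fun a => rfl }
  have hgx : ∀ x, g x = x.fst := fun x => rfl
  have hg : Function.Surjective g := fun k => ⟨TrivSqZeroExt.inl k, rfl⟩
  have hker : RingHom.ker (g : TrivSqZeroExt K K →+* K) = TrivSqZeroExt.kerIdeal K K :=
    Ideal.ext fun x => ⟨fun h => h, fun h => h⟩
  have hg' : IsNilpotent (RingHom.ker (g : TrivSqZeroExt K K →+* K)) :=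
    ⟨2, by rw [hker, TrivSqZeroExt.kerIdeal_sq]; rfl⟩
  -- `P` as an `R`-algebra map, and its lift to `K[ε]`
  let f : S →ₐ[R] K := { P with commutes' := fun a => rfl }
  have hfx : ∀ x, f x = P x := fun x => rfl
  let L : S →ₐ[R] TrivSqZeroExt K K := Algebra.FormallySmooth.liftOfSurjective f g hg hg'
  have hL : ∀ x, (L x).fst = P x := fun x => by
    rw [← hfx, ← hgx]
    exact Algebra.FormallySmooth.liftOfSurjective_apply f g hg hg' x
  refine ⟨{ toFun := fun x => (L x).snd
            map_zero' := by simp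
            map_add' := fun x y => by simp }, fun x y => ?_, fun a => ?_⟩
  · show (L (x * y)).snd = P x * (L y).snd + P y * (L x).snd
    rw [map_mul, TrivSqZeroExt.snd_mul, hL, hL, smul_eq_mul, MulOpposite.smul_eq_mul_unop,
      MulOpposite.unop_op]
    ring
  · show (L (φ a)).snd = D a
    have h1 : L (algebraMap R S a) = algebraMap R (TrivSqZeroExt K K) a := L.commutes a
    have h2 : (algebraMap R (TrivSqZeroExt K K) a).snd = D a := rfl
    rw [← h2, ← h1]
    rfl

end Literature.RingTheory.Smooth
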